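import Summits.BirchSwinnertonDyer.BirchSwinnertonDyer.Theorems.AdditiveKolyvaginRoadManinFrameResidueProperROfKato
import Summits.BirchSwinnertonDyer.BirchSwinnertonDyer.Theorems.EdixhovenFibreFiveSevenStarredOptimalManinUnitFiveSevenAssembly
import Literature.NumberTheory.PAdicHodge.DualExpOfDeRham
import HarnessLib

/-!
# AKR crux #7 `ManinFrameResidueProperR` ⟸ the four cite facts of the assembled F″ programme
# {P1 = `Kato2004.exists_member_sl2ZetaElement_neron_values`, (S5b-tower), Kato II Prop 1.2.3, de Rham}

Cell `pub/bsd-wall`, seat `bsd-wall-manin-p1` g8 (explicit-unit; crux of record stmt-BirchSwinnertonDyer-20709;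
`--supports stmt-BirchSwinnertonDyer-20709`, helper). ONE composition theorem, nothing else: g7's closer
`ManinFrameResidueProperROfKatoLTwist.maninFrameResidueProperR_of_kato : F″ → ManinFrameResidueProperR` (p596221)
∘ the F″ programme's final assembly `KatoAssemblySocket.kato_neron_five_le_of_sl2NeronValues` (edix-p4 g3, E2E-tested
by edix-p3 g4), where F″ = `kato_neron_isIntegral_twistedSymbolSum_of_additive_five_le` is now a kernel theorem from the
named facts P1 (`Literature.NumberTheory.EllipticCurves.Kato2004.exists_member_sl2ZetaElement_neron_values`, typed by this
seat, p603032), (S5b-tower) `PAdicHodge.exists_smul_range_expStarCoord_tower_iff_trace_log`, Kato LNM 1553 II Prop 1.2.3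
`PAdicHodge.cupLogInjective_and_hasDualExp_of_isDeRham` and `PAdicHodge.isDeRham_restrictedRationalTateRep`.
CONDITIONAL RESULT (the four facts are displayed hypotheses); the item stays open (conditional-result, blocked-on the
four cite facts instead of F″); BSD is not proved by any of this.
-/

set_option autoImplicit false
-- the Theorems directory repeats the summit name (D-0017)
set_option linter.dupNamespace false

noncomputable section

open Literature.NumberTheory.EllipticCurves Literature.NumberTheory.PAdicHodge
  Summit.BirchSwinnertonDyer.BirchSwinnertonDyer.Theses.AdditiveKolyvaginRoad

namespace Summit.BirchSwinnertonDyer.BirchSwinnertonDyer.Theorems.ManinFrameResidueProperROfSL2NeronValues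

/-- **AKR crux #7 `ManinFrameResidueProperR` from the four cite facts of the F″ programme** (P1 = Kato 2004
(8.1.3)/9.7/6.6(1) SL₂(ℤ)/13.6 in a Néron coordinate; (S5b-tower) = Kato II 1.4.1 + BK90 3.8 at two levels; Kato II
Prop 1.2.3; de Rham of `V_pE`): `maninFrameResidueProperR_of_kato` ∘ `kato_neron_five_le_of_sl2NeronValues`.
CONDITIONAL RESULT; the item stays open; BSD is not proved by this.
[cite: Kato2004Asterisque, (8.1.3) (p. 180), Thm. 9.7 (p. 189), Thm. 6.6 (1) (p. 163), Thm. 13.6 (p. 227)]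
[cite: Kato1993LNM1553, Ch. II Prop. 1.2.3 and Thm. 1.4.1 (3)-(4)] [cite: BlochKato1990, Prop. 3.8, Example 3.11] -/
theorem maninFrameResidueProperR_of_sl2NeronValues
    (hT₂ : exists_smul_range_expStarCoord_tower_iff_trace_log)
    (hP : cupLogInjective_and_hasDualExp_of_isDeRham)
    (hDR : isDeRham_restrictedRationalTateRep)
    (hP1 : Kato2004.exists_member_sl2ZetaElement_neron_values) : ManinFrameResidueProperR :=
  ManinFrameResidueProperROfKatoLTwist.maninFrameResidueProperR_of_kato
    (KatoAssemblySocket.kato_neron_five_le_of_sl2NeronValues hT₂ hP hDR hP1)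

/-- **AKR crux #7 `ManinFrameResidueProperR`, re-keyed on the WEAKER Prop-1.2.3 input** (seat `bsd-wall-manin-p1`
g9): the same composition, with Kato II Prop. 1.2.3 demanded only through its SURJECTIVITY half
`hasDualExp_of_isDeRham` (every continuous crossed homomorphism of a de Rham `V` admits a dual exponential)
— the injectivity half `CupLogInjective` being the tree theorem `cupLogInjective_of_isDeRham` (file
`Literature/NumberTheory/PAdicHodge/CupLogInjectiveDeRham`), folded in by
`cupLogInjective_and_hasDualExp_of_isDeRham_of_hasDualExp`. The cite cone of the crux is thus
{P1 = Kato 2004 (8.1.3)/9.7/6.6(1)/13.6 in a Néron coordinate, (S5b-tower), Kato II Prop. 1.2.3 SURJECTIVITY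
half, de Rham of `V_pE`}. CONDITIONAL RESULT; the item stays open; BSD is not proved by this.
[cite: Kato2004Asterisque, (8.1.3) (p. 180), Thm. 9.7 (p. 189), Thm. 6.6 (1) (p. 163), Thm. 13.6 (p. 227)]
[cite: Kato1993LNM1553, Ch. II Prop. 1.2.3 and Thm. 1.4.1 (3)-(4)] [cite: BlochKato1990, Prop. 3.8, Example 3.11] -/
theorem maninFrameResidueProperR_of_sl2NeronValues_of_hasDualExp
    (hT₂ : exists_smul_range_expStarCoord_tower_iff_trace_log)
    (hP' : hasDualExp_of_isDeRham)
    (hDR : isDeRham_restrictedRationalTateRep)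
    (hP1 : Kato2004.exists_member_sl2ZetaElement_neron_values) : ManinFrameResidueProperR :=
  maninFrameResidueProperR_of_sl2NeronValues hT₂
    (cupLogInjective_and_hasDualExp_of_isDeRham_of_hasDualExp hP') hDR hP1

end Summit.BirchSwinnertonDyer.BirchSwinnertonDyer.Theorems.ManinFrameResidueProperROfSL2NeronValues

end
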